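import Mathlib.RingTheory.Derivation.Basic
import Mathlib.LinearAlgebra.Matrix.Determinant.Basic
import Mathlib.Algebra.MvPolynomial.PDeriv
import Mathlib.RingTheory.MvPolynomial.Homogeneous
import HarnessLib

/-!
# Iterated derivations along words, the higher Leibniz rule, and Taylor vanishing for polynomials

Topic: `Literature/RingTheory/MvPolynomial`. Bookkeeping used in Nesterenko's proof of the bound
for the Hilbert function of a prime ideal ([Nes3] = Yu. V. Nesterenko, *Estimates for the
characteristic function of a prime ideal*, Mat. Sb. 123 (1984); LNM 1752 Ch. 10 Lemma 3.1):

* `iterD δ w` — the composite `δ_{c₁} ∘ ⋯ ∘ δ_{c_k}` of a family of maps `δ : C → B → B` along a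
  word `w = [c₁, …, c_k]`; `splits w` — the `2^k` ordered splittings of `w` into two complementary
  sub-words; **`iterD_mul`** — the higher Leibniz rule
  `δ_w(xy) = Σ_{(w₁,w₂) ∈ splits w} δ_{w₁}(x) δ_{w₂}(y)` for a family of derivations;
* `VanUpTo τ δ n x` — "all derivatives of `x` of order `≤ n` vanish under the ring homomorphism
  `τ`"; it is preserved by sums, by multiplication with ANYTHING (`VanUpTo.mul_right`), and
  **`VanUpTo.mul`**: orders add plus one (`VanUpTo n x → VanUpTo n' y → VanUpTo (n+n'+1) (xy)`, the
  pigeonhole on a splitting), whence `VanUpTo.prod` and **`VanUpTo.det`**: if every entry of a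
  `g × g` matrix vanishes to order `n` then its determinant vanishes to order `g(n+1) − 1`;
* for `B = MvPolynomial σ R` and `δ = pderiv`: `coeff_iterD_pderiv` (the coefficients of an
  iterated partial derivative), and **Taylor vanishing**
  `eq_zero_of_forall_coeff_zero_iterD_pderiv` / `eq_zero_of_forall_eval_iterD_pderiv`: a
  polynomial over a domain of characteristic zero all of whose iterated partial derivatives of
  order `≤ deg P` vanish at a point is zero.

[folklore]
-/

noncomputable section

namespace Literature.RingTheory.MvPolynomial

open scoped BigOperators

/-! ### Iterating a family of maps along a word -/

section IterD

variable {C B : Type*}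

/-- `iterD δ [c₁, …, c_k] = δ c₁ ∘ ⋯ ∘ δ c_k`. [folklore] -/
def iterD (δ : C → B → B) : List C → B → B
  | [] => id
  | c :: w => δ c ∘ iterD δ w

/-- The empty word acts as the identity. [folklore] -/
@[simp] theorem iterD_nil (δ : C → B → B) (x : B) : iterD δ [] x = x := rfl

/-- Unfolding `iterD` along `c :: w`. [folklore] -/
@[simp] theorem iterD_cons (δ : C → B → B) (c : C) (w : List C) (x : B) :
    iterD δ (c :: w) x = δ c (iterD δ w x) := rfl

/-- `iterD` along a concatenation is the composite. [folklore] -/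
theorem iterD_append (δ : C → B → B) (w₁ w₂ : List C) (x : B) :
    iterD δ (w₁ ++ w₂) x = iterD δ w₁ (iterD δ w₂ x) := by
  induction w₁ with
  | nil => rfl
  | cons c w ih => simp [ih]

/-- `iterD` along a singleton. [folklore] -/
@[simp] theorem iterD_singleton (δ : C → B → B) (c : C) (x : B) : iterD δ [c] x = δ c x := rfl

/-- The ordered splittings of a word into two complementary sub-words (each letter goes left or
right). [folklore] -/
def splits : List C → List (List C × List C)
  | [] => [([], [])]
  | c :: w => (splits w).flatMap fun p => [(c :: p.1, p.2), (p.1, c :: p.2)]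

/-- The empty word has the single splitting `([], [])`. [folklore] -/
@[simp] theorem splits_nil : splits ([] : List C) = [([], [])] := rfl

/-- Unfolding `splits` along `c :: w`: the new letter goes left or right. [folklore] -/
theorem splits_cons (c : C) (w : List C) :
    splits (c :: w) = (splits w).flatMap fun p => [(c :: p.1, p.2), (p.1, c :: p.2)] := rfl

/-- The two parts of a splitting have complementary lengths. [folklore] -/
theorem length_add_length_of_mem_splits {w : List C} {p : List C × List C} (hp : p ∈ splits w) :
    p.1.length + p.2.length = w.length := by
  induction w generalizing p with
  | nil =>
    simp only [splits_nil, List.mem_singleton] at hp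
    subst hp; rfl
  | cons c w ih =>
    simp only [splits_cons, List.mem_flatMap, List.mem_cons, List.not_mem_nil, or_false] at hp
    obtain ⟨q, hq, rfl | rfl⟩ := hp
    · simp only [List.length_cons]; have := ih hq; omega
    · simp only [List.length_cons]; have := ih hq; omega

end IterD

/-! ### Families of derivations: additivity and the higher Leibniz rule -/

section Derivations

variable {R C B : Type*} [CommRing R] [CommRing B] [Algebra R B] (δ : C → Derivation R B B)

/-- The underlying family of maps of a family of derivations. [folklore] -/
abbrev dmap : C → B → B := fun c => ⇑(δ c)

/-- Iterated derivations are additive. [folklore] -/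
theorem iterD_add (w : List C) (x y : B) :
    iterD (dmap δ) w (x + y) = iterD (dmap δ) w x + iterD (dmap δ) w y := by
  induction w with
  | nil => rfl
  | cons c w ih => simp [ih, map_add]

/-- Iterated derivations kill `0`. [folklore] -/
theorem iterD_zero (w : List C) : iterD (dmap δ) w (0 : B) = 0 := by
  induction w with
  | nil => rfl
  | cons c w ih => simp [ih]

/-- Iterated derivations commute with negation. [folklore] -/
theorem iterD_neg (w : List C) (x : B) : iterD (dmap δ) w (-x) = -iterD (dmap δ) w x := by
  induction w with
  | nil => rfl
  | cons c w ih => simp [ih, map_neg]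

/-- Iterated derivations commute with subtraction. [folklore] -/
theorem iterD_sub (w : List C) (x y : B) :
    iterD (dmap δ) w (x - y) = iterD (dmap δ) w x - iterD (dmap δ) w y := by
  rw [sub_eq_add_neg, iterD_add, iterD_neg, sub_eq_add_neg]

/-- Iterated derivations commute with finite sums. [folklore] -/
theorem iterD_sum {ι : Type*} (s : Finset ι) (f : ι → B) (w : List C) :
    iterD (dmap δ) w (∑ i ∈ s, f i) = ∑ i ∈ s, iterD (dmap δ) w (f i) := by
  classical
  induction s using Finset.induction_on with
  | empty => simp [iterD_zero]
  | insert a s ha ih => rw [Finset.sum_insert ha, Finset.sum_insert ha, iterD_add, ih]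

/-- Iterated derivations commute with integer scalars. [folklore] -/
theorem iterD_zsmul (w : List C) (n : ℤ) (x : B) :
    iterD (dmap δ) w (n • x) = n • iterD (dmap δ) w x := by
  induction w with
  | nil => rfl
  | cons c w ih => rw [iterD_cons, iterD_cons, ih, dmap, map_zsmul]

/-- Iterated derivations commute with list sums. [folklore] -/
theorem iterD_list_sum (w : List C) (l : List B) :
    iterD (dmap δ) w l.sum = (l.map (iterD (dmap δ) w)).sum := by
  induction l with
  | nil => simp [iterD_zero]
  | cons b l ih => simp [iterD_add, ih]

/-- **Higher Leibniz rule**: `∂_w(xy) = Σ_{(w₁,w₂) ∈ splits w} ∂_{w₁}(x) · ∂_{w₂}(y)`. [folklore] -/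
theorem iterD_mul (w : List C) (x y : B) :
    iterD (dmap δ) w (x * y) =
      ((splits w).map fun p => iterD (dmap δ) p.1 x * iterD (dmap δ) p.2 y).sum := by
  induction w with
  | nil => simp
  | cons c w ih =>
    rw [iterD_cons, ih, splits_cons]
    generalize splits w = L
    induction L with
    | nil => simp [dmap]
    | cons p l ihl =>
      simp only [List.map_cons, List.sum_cons, List.flatMap_cons, List.map_append,
        List.sum_append]
      rw [← ihl, dmap, map_add, (δ c).leibniz]
      simp only [smul_eq_mul, iterD_cons, dmap, List.map_nil, List.sum_nil, add_zero]
      ring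

end Derivations

/-! ### Vanishing of all derivatives up to a given order under a ring homomorphism -/

section Van

variable {R C B T : Type*} [CommRing R] [CommRing B] [Algebra R B] [CommRing T]
  (τ : B →+* T) (δ : C → Derivation R B B)

/-- `VanUpTo τ δ n x`: `τ(δ_w x) = 0` for every word `w` of length `≤ n`. [folklore] -/
def VanUpTo (n : ℕ) (x : B) : Prop :=
  ∀ w : List C, w.length ≤ n → τ (iterD (dmap δ) w x) = 0

variable {τ δ}

namespace VanUpTo

/-- Vanishing to order `n` implies vanishing to any smaller order. [folklore] -/
theorem mono {n n' : ℕ} (h : n' ≤ n) {x : B} (hx : VanUpTo τ δ n x) : VanUpTo τ δ n' x :=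
  fun w hw => hx w (hw.trans h)

/-- `0` vanishes to every order. [folklore] -/
theorem zero (n : ℕ) : VanUpTo τ δ n (0 : B) := fun w _ => by rw [iterD_zero, map_zero]

/-- Sums preserve the order of vanishing. [folklore] -/
theorem add {n : ℕ} {x y : B} (hx : VanUpTo τ δ n x) (hy : VanUpTo τ δ n y) :
    VanUpTo τ δ n (x + y) := fun w hw => by rw [iterD_add, map_add, hx w hw, hy w hw, add_zero]

/-- Negation preserves the order of vanishing. [folklore] -/
theorem neg {n : ℕ} {x : B} (hx : VanUpTo τ δ n x) : VanUpTo τ δ n (-x) := fun w hw => by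
  rw [iterD_neg, map_neg, hx w hw, neg_zero]

/-- Differences preserve the order of vanishing. [folklore] -/
theorem sub {n : ℕ} {x y : B} (hx : VanUpTo τ δ n x) (hy : VanUpTo τ δ n y) :
    VanUpTo τ δ n (x - y) := by
  rw [sub_eq_add_neg]; exact hx.add hy.neg

/-- Integer multiples preserve the order of vanishing. [folklore] -/
theorem zsmul {n : ℕ} {x : B} (hx : VanUpTo τ δ n x) (k : ℤ) : VanUpTo τ δ n (k • x) :=
  fun w hw => by rw [iterD_zsmul, map_zsmul, hx w hw, smul_zero]

/-- Finite sums preserve the order of vanishing. [folklore] -/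
theorem sum {ι : Type*} {s : Finset ι} {f : ι → B} {n : ℕ} (h : ∀ i ∈ s, VanUpTo τ δ n (f i)) :
    VanUpTo τ δ n (∑ i ∈ s, f i) := fun w hw => by
  rw [iterD_sum, map_sum]
  exact Finset.sum_eq_zero fun i hi => h i hi w hw

/-- The value of `τ` itself vanishes. [folklore] -/
theorem apply_eq_zero {n : ℕ} {x : B} (hx : VanUpTo τ δ n x) : τ x = 0 := hx [] (Nat.zero_le _)

/-- Applying one more derivation lowers the order by one. [folklore] -/
theorem deriv {n : ℕ} {x : B} (hx : VanUpTo τ δ (n + 1) x) (c : C) : VanUpTo τ δ n (δ c x) :=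
  fun w hw => by
    have := hx (w ++ [c]) (by simp; omega)
    rwa [iterD_append] at this

/-- **Pigeonhole Leibniz**: `VanUpTo n x → VanUpTo n' y → VanUpTo (n + n' + 1) (x * y)`. [folklore] -/
theorem mul {n n' : ℕ} {x y : B} (hx : VanUpTo τ δ n x) (hy : VanUpTo τ δ n' y) :
    VanUpTo τ δ (n + n' + 1) (x * y) := fun w hw => by
  rw [iterD_mul, map_list_sum, List.map_map]
  refine List.sum_eq_zero fun t ht => ?_
  obtain ⟨p, hp, rfl⟩ := List.mem_map.mp ht
  have hlen := length_add_length_of_mem_splits hp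
  simp only [Function.comp_apply, map_mul]
  by_cases h1 : p.1.length ≤ n
  · rw [hx _ h1, zero_mul]
  · have h2 : p.2.length ≤ n' := by omega
    rw [hy _ h2, mul_zero]

/-- Multiplying by anything keeps the order of vanishing. [folklore] -/
theorem mul_right {n : ℕ} {x : B} (hx : VanUpTo τ δ n x) (y : B) : VanUpTo τ δ n (x * y) :=
  fun w hw => by
    rw [iterD_mul, map_list_sum, List.map_map]
    refine List.sum_eq_zero fun t ht => ?_
    obtain ⟨p, hp, rfl⟩ := List.mem_map.mp ht
    have hlen := length_add_length_of_mem_splits hp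
    simp only [Function.comp_apply, map_mul]
    rw [hx _ (by omega), zero_mul]

/-- Multiplying on the left by anything keeps the order of vanishing. [folklore] -/
theorem mul_left {n : ℕ} {y : B} (x : B) (hy : VanUpTo τ δ n y) : VanUpTo τ δ n (x * y) := by
  rw [mul_comm]; exact hy.mul_right x

/-- **Products**: if each of the `|s| ≥ 1` factors vanishes to order `n`, the product vanishes to
order `|s|·(n+1) − 1`. [folklore] -/
theorem prod {ι : Type*} {s : Finset ι} {f : ι → B} {n : ℕ} (hs : s.Nonempty)
    (h : ∀ i ∈ s, VanUpTo τ δ n (f i)) : VanUpTo τ δ (s.card * (n + 1) - 1) (∏ i ∈ s, f i) := by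
  classical
  induction s using Finset.induction_on with
  | empty => exact absurd hs Finset.not_nonempty_empty
  | insert a s ha ih =>
    rw [Finset.prod_insert ha, Finset.card_insert_of_notMem ha]
    by_cases hs' : s.Nonempty
    · have h1 := ih hs' fun i hi => h i (Finset.mem_insert_of_mem hi)
      have h2 := (h a (Finset.mem_insert_self a s)).mul h1
      refine h2.mono ?_
      have : 1 ≤ s.card := Finset.card_pos.mpr hs'
      have : 1 ≤ s.card * (n + 1) := Nat.one_le_iff_ne_zero.mpr (by positivity)
      rw [add_mul, one_mul]
      omega
    · rw [Finset.not_nonempty_iff_eq_empty.mp hs']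
      simpa using h a (Finset.mem_insert_self a s)

/-- **Determinants**: if every entry of a `g × g` matrix (`g ≥ 1`) vanishes to order `n`, its
determinant vanishes to order `g(n+1) − 1`. [folklore] -/
theorem det {g : ℕ} (hg : 1 ≤ g) {M : Matrix (Fin g) (Fin g) B} {n : ℕ}
    (h : ∀ i j, VanUpTo τ δ n (M i j)) : VanUpTo τ δ (g * (n + 1) - 1) M.det := by
  rw [Matrix.det_apply]
  refine VanUpTo.sum fun σ _ => ?_
  rw [Units.smul_def]
  refine VanUpTo.zsmul ?_ _
  have hne : (Finset.univ : Finset (Fin g)).Nonempty := ⟨⟨0, hg⟩, Finset.mem_univ _⟩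
  have := VanUpTo.prod (τ := τ) (δ := δ) (f := fun i => M (σ i) i) hne fun i _ => h (σ i) i
  rwa [Finset.card_univ, Fintype.card_fin] at this

end VanUpTo

/-- `VanUpTo` is transported along a ring homomorphism intertwining two families of derivations.
[folklore] -/
theorem VanUpTo.of_map {B' : Type*} [CommRing B'] [Algebra R B'] {δ' : C → Derivation R B' B'}
    {τ' : B' →+* T} (φ : B →+* B') (hφ : ∀ c x, φ (δ c x) = δ' c (φ x))
    (hτ : ∀ x, τ' (φ x) = τ x) {n : ℕ} {x : B} (hx : VanUpTo τ δ n x) :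
    VanUpTo τ' δ' n (φ x) := by
  intro w hw
  have key : ∀ w : List C, iterD (dmap δ') w (φ x) = φ (iterD (dmap δ) w x) := by
    intro w
    induction w with
    | nil => rfl
    | cons c w ih => simp [ih, hφ]
  rw [key, hτ]
  exact hx w hw

end Van

/-! ### Iterated partial derivatives of polynomials and Taylor vanishing -/

section Taylor

open _root_.MvPolynomial

variable {σ R : Type*} [CommRing R]

/-- The exponent vector counted by a word: `counts [c₁, …, c_k] = Σ e_{cᵢ}`. [folklore] -/
def counts (w : List σ) : σ →₀ ℕ := (w.map fun i => Finsupp.single i 1).sum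

/-- The empty word counts the zero exponent. [folklore] -/
@[simp] theorem counts_nil : counts ([] : List σ) = 0 := rfl

/-- Unfolding `counts` along `c :: w`. [folklore] -/
@[simp] theorem counts_cons (c : σ) (w : List σ) :
    counts (c :: w) = Finsupp.single c 1 + counts w := rfl

/-- The total degree counted by a word is its length. [folklore] -/
theorem degree_counts (w : List σ) : (counts w).degree = w.length := by
  induction w with
  | nil => simp
  | cons c w ih => rw [counts_cons, map_add, ih, Finsupp.degree_single]; simp; omega

/-- The Taylor factor `∏ (falling factorial data)`: `tf e [] = 1`,
`tf e (c :: w) = (e_c + |w|_c… )`; precisely the integer with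
`coeff e (δ_w P) = tf e w · coeff (e + counts w) P`. [folklore] -/
def taylorFactor : List σ → (σ →₀ ℕ) → ℕ
  | [], _ => 1
  | c :: w, e => (e c + 1) * taylorFactor w (e + Finsupp.single c 1)

/-- The Taylor factor is a positive integer. [folklore] -/
theorem taylorFactor_pos (w : List σ) (e : σ →₀ ℕ) : 0 < taylorFactor w e := by
  induction w generalizing e with
  | nil => exact Nat.one_pos
  | cons c w ih => exact Nat.mul_pos (Nat.succ_pos _) (ih _)

/-- **Coefficients of an iterated partial derivative**:
`coeff e (∂_w P) = taylorFactor w e · coeff (e + counts w) P`. [folklore] -/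
theorem coeff_iterD_pderiv (w : List σ) (e : σ →₀ ℕ) (P : MvPolynomial σ R) :
    coeff e (iterD (dmap fun i : σ => pderiv (R := R) i) w P) =
      (taylorFactor w e : R) * coeff (e + counts w) P := by
  induction w generalizing e with
  | nil => simp [taylorFactor]
  | cons c w ih =>
    rw [iterD_cons, dmap, coeff_pderiv, ih, counts_cons, taylorFactor, add_assoc]
    push_cast
    ring

/-- `counts` of a concatenation. [folklore] -/
theorem counts_append (w₁ w₂ : List σ) : counts (w₁ ++ w₂) = counts w₁ + counts w₂ := by
  simp [counts, List.map_append, List.sum_append]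

/-- `counts` of a constant word. [folklore] -/
theorem counts_replicate (n : ℕ) (a : σ) : counts (List.replicate n a) = Finsupp.single a n := by
  induction n with
  | zero => simp [counts]
  | succ k ih => rw [List.replicate_succ, counts_cons, ih, ← Finsupp.single_add, add_comm]

/-- A word realising a given exponent vector. [folklore] -/
theorem exists_counts_eq (e : σ →₀ ℕ) : ∃ w : List σ, counts w = e ∧ w.length = e.degree := by
  classical
  induction e using Finsupp.induction with
  | zero => exact ⟨[], rfl, by simp⟩
  | single_add a n f ha hn ih =>
    obtain ⟨w, hw, hl⟩ := ih
    refine ⟨List.replicate n a ++ w, ?_, ?_⟩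
    · rw [counts_append, counts_replicate, hw]
    · rw [List.length_append, List.length_replicate, hl, map_add, Finsupp.degree_single]

/-- **Taylor vanishing at the origin**: over a domain of characteristic zero, if the constant
coefficient of every iterated partial derivative of `P` of order `≤ deg P` vanishes then `P = 0`.
[folklore] -/
theorem eq_zero_of_forall_coeff_zero_iterD_pderiv [IsDomain R] [CharZero R] {P : MvPolynomial σ R}
    (h : ∀ w : List σ, w.length ≤ P.totalDegree →
      coeff 0 (iterD (dmap fun i : σ => pderiv (R := R) i) w P) = 0) : P = 0 := by
  classical
  by_contra hP
  obtain ⟨e, he⟩ : ∃ e, e ∈ P.support := Finset.nonempty_iff_ne_empty.mpr (by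
    rwa [Ne, MvPolynomial.support_eq_empty])
  obtain ⟨w, hw, hl⟩ := exists_counts_eq e
  have hdeg : w.length ≤ P.totalDegree := by
    rw [hl]
    exact MvPolynomial.le_totalDegree he
  have h1 := h w hdeg
  rw [coeff_iterD_pderiv, zero_add, hw] at h1
  rcases mul_eq_zero.mp h1 with h2 | h2
  · exact absurd h2 (by exact_mod_cast (taylorFactor_pos w (0 : σ →₀ ℕ)).ne')
  · exact (MvPolynomial.mem_support_iff.mp he) h2

/-- The shift automorphism `Xᵢ ↦ Xᵢ + aᵢ`. [folklore] -/
def shift (a : σ → R) : MvPolynomial σ R →ₐ[R] MvPolynomial σ R :=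
  aeval fun i => X i + C (a i)

/-- The shift on a variable. [folklore] -/
theorem shift_X (a : σ → R) (i : σ) : shift a (X i) = X i + C (a i) := aeval_X _ i

/-- Shifts compose additively; in particular `shift (-a)` inverts `shift a`. [folklore] -/
theorem shift_shift (a b : σ → R) (P : MvPolynomial σ R) :
    shift a (shift b P) = shift (a + b) P := by
  induction P using MvPolynomial.induction_on with
  | C r => simp [shift]
  | add p q hp hq => rw [map_add, map_add, hp, hq, map_add]
  | mul_X p i hp =>
    rw [map_mul, map_mul, hp, map_mul, shift_X, shift_X, map_add, shift_X]
    simp [shift, add_assoc]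

/-- Shifting by `0` is the identity. [folklore] -/
theorem shift_zero (P : MvPolynomial σ R) : shift (0 : σ → R) P = P := by
  have : (fun i : σ => X i + C ((0 : σ → R) i)) = X := by funext i; simp
  rw [shift, this, aeval_X_left, AlgHom.id_apply]

/-- Shifts are injective. [folklore] -/
theorem shift_injective (a : σ → R) : Function.Injective (shift a) := fun P Q h => by
  have := congrArg (shift (-a)) h
  rwa [shift_shift, shift_shift, neg_add_cancel, shift_zero, shift_zero] at this

/-- Evaluating a shift: `(shift a P)(b) = P(b + a)`. [folklore] -/
theorem eval_shift (a b : σ → R) (P : MvPolynomial σ R) :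
    eval b (shift a P) = eval (b + a) P := by
  induction P using MvPolynomial.induction_on with
  | C r => simp [shift]
  | add p q hp hq => rw [map_add, map_add, hp, hq, map_add]
  | mul_X p i hp => rw [map_mul, map_mul, hp, shift_X, map_mul]; simp

/-- Shifts commute with partial derivatives. [folklore] -/
theorem shift_pderiv (a : σ → R) (i : σ) (P : MvPolynomial σ R) :
    shift a (pderiv i P) = pderiv i (shift a P) := by
  classical
  induction P using MvPolynomial.induction_on with
  | C r => simp [shift]
  | add p q hp hq => rw [map_add, map_add, hp, hq, map_add, map_add]
  | mul_X p k hp =>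
    rw [pderiv_mul, map_add, map_mul, map_mul, hp, map_mul, shift_X, pderiv_mul, map_add,
      pderiv_C, add_zero]
    congr 2
    by_cases hki : k = i
    · subst hki; rw [pderiv_X_self, map_one]
    · rw [pderiv_X_of_ne hki, map_zero]

/-- Shifts commute with iterated partial derivatives. [folklore] -/
theorem shift_iterD_pderiv (a : σ → R) (w : List σ) (P : MvPolynomial σ R) :
    shift a (iterD (dmap fun i : σ => pderiv (R := R) i) w P) =
      iterD (dmap fun i : σ => pderiv (R := R) i) w (shift a P) := by
  induction w with
  | nil => rfl
  | cons c w ih => rw [iterD_cons, iterD_cons, dmap, shift_pderiv, ih]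

/-- Substituting polynomials of degree `≤ 1` does not increase the total degree. [folklore] -/
theorem totalDegree_aeval_le_of_le_one {S τ : Type*} [CommSemiring S]
    (h : σ → MvPolynomial τ S) (hh : ∀ i, (h i).totalDegree ≤ 1) (g : MvPolynomial σ S) :
    (aeval h g).totalDegree ≤ g.totalDegree := by
  conv_lhs => rw [g.as_sum]
  rw [map_sum]
  refine totalDegree_finsetSum_le fun d hd => ?_
  rw [aeval_monomial, ← C_eq_algebraMap]
  refine (totalDegree_mul _ _).trans ?_
  rw [totalDegree_C, zero_add, Finsupp.prod]
  refine (totalDegree_finsetProd _ _).trans ?_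
  calc ∑ i ∈ d.support, (h i ^ d i).totalDegree ≤ ∑ i ∈ d.support, d i := by
        gcongr with i
        calc (h i ^ d i).totalDegree ≤ d i * (h i).totalDegree := totalDegree_pow _ _
          _ ≤ d i * 1 := Nat.mul_le_mul_left _ (hh i)
          _ = d i := mul_one _
    _ ≤ g.totalDegree := le_totalDegree hd

/-- A shift does not increase the total degree. [folklore] -/
theorem totalDegree_shift_le [Nontrivial R] (a : σ → R) (P : MvPolynomial σ R) :
    (shift a P).totalDegree ≤ P.totalDegree :=
  totalDegree_aeval_le_of_le_one _ (fun i => (totalDegree_add _ _).trans (by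
    rw [totalDegree_X, totalDegree_C]; simp)) P

/-- **Taylor vanishing at a point**: over a domain of characteristic zero, if every iterated
partial derivative of `P` of order `≤ deg P` vanishes at `a` then `P = 0`. [folklore] -/
theorem eq_zero_of_forall_eval_iterD_pderiv [IsDomain R] [CharZero R] (a : σ → R)
    {P : MvPolynomial σ R}
    (h : ∀ w : List σ, w.length ≤ P.totalDegree →
      eval a (iterD (dmap fun i : σ => pderiv (R := R) i) w P) = 0) : P = 0 := by
  apply shift_injective a
  rw [map_zero]
  refine eq_zero_of_forall_coeff_zero_iterD_pderiv fun w hw => ?_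
  have hw' : w.length ≤ P.totalDegree := hw.trans (totalDegree_shift_le a P)
  have h1 := h w hw'
  rw [← shift_iterD_pderiv, ← constantCoeff_eq, ← eval_zero, eval_shift, zero_add, h1]

end Taylor

end Literature.RingTheory.MvPolynomial
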